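import Summits.QuantumFields.YangMills.Theorems.FradkinShenkerFlowPoincareToClusteringPropagation
import Summits.QuantumFields.YangMills.Theorems.FradkinShenkerFlowSusceptibilityToPoincareTwoBlockFactorization

/-!
# Covariance decay on one torus from the heat-bath Poincaré inequality

Route `FradkinShenkerFlow` of `YangMills`, support item `stmt-QuantumFields-9444`
(`Summit.QuantumFields.YangMills.Theses.FradkinShenkerFlow.PoincareToClustering`, UP ⇒ EC).

`abs_cov_le`: on the torus of side `L`, if the Wilson measure `μ = wilsonMeasure ρ β` satisfies
the single-link heat-bath Poincaré inequality with constant `C ≥ 1`, then for bounded measurable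
`f, g` such that `f` reads only the links in `T_f`, every link of `T_f` has cyclic time distance
at least `n_R` from the slice `c`, and the oscillations of `g` decay like `A₀ a^{tdist c ℓ}`
(`0 < a ≤ 1`), one has for every Glauber time `k : ℕ`

  `|∫ f g dμ − ∫ f dμ ∫ g dμ| ≤ 2 M_f M_g e^{−k/(4C)} + k |T_f| M_f A₀ e^{2Dk/a} a^{n_R}`.

Proof (discrete-time heat bath, files `…HeatBath`, `…Gap`, `…Propagation`): with
`g₀ = g − ∫ g` and the random scan `K`, telescope
`∫ f g₀ = ∫ f K^J g₀ + ∑_{j<J} ∫ f (K^j g₀ − K^{j+1} g₀)`, `J = k|E|`.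
The first term is at most `M_f ‖K^J g₀‖₂ ≤ 2 M_f M_g (1 − (2C|E|)⁻¹)^{J/2} ≤ 2 M_f M_g e^{−k/(4C)}`
(gap, `integral_sq_scanIter_le`). In the sum, `h − K h = |E|⁻¹ ∑_ℓ (h − E_ℓ h)`; the links
`ℓ ∉ T_f` contribute `0` (pull-out and DLR), and a link `ℓ ∈ T_f` contributes at most
`M_f osc_ℓ(K^j g₀) ≤ M_f A₀ (1 + 2D/(a|E|))^J a^{n_R}` (finite speed, `osc_scanIter_le_geom`);
there are `J |T_f|` such terms each weighted `|E|⁻¹`, and `(1 + 2D/(a|E|))^{k|E|} ≤ e^{2Dk/a}`.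

References: F. Martinelli, LNM 1717 (1999), §3; T. Liggett, *Interacting Particle Systems*
(2005), Ch. I §4.
-/

noncomputable section

open MeasureTheory ProbabilityTheory
open Literature.MathematicalPhysics.QuantumFieldTheory

namespace Summit.QuantumFields.YangMills.Theorems.PoincareClustering

section Covariance

variable {d L N : ℕ} {G : Type*} [Group G] [TopologicalSpace G] [IsTopologicalGroup G]
  [CompactSpace G] [MeasurableSpace G] [BorelSpace G] [NeZero L]
  (ρ : G →* Matrix (Fin N) (Fin N) ℂ) (β : ℝ)

omit [TopologicalSpace G] [IsTopologicalGroup G] [CompactSpace G] [BorelSpace G] [NeZero L] in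
/-- `|∫ f h dμ| ≤ M_f √(∫ h² dμ)` for `|f| ≤ M_f` on a probability space (Cauchy–Schwarz).
[folklore] -/
theorem abs_integral_mul_le_mul_sqrt {μ : Measure (GaugeConfig d L G)} [IsProbabilityMeasure μ]
    {f h : GaugeConfig d L G → ℝ} (hf : Measurable f) (hh : Measurable h) {Mf Mh : ℝ}
    (hMf : ∀ U, |f U| ≤ Mf) (hMh : ∀ U, |h U| ≤ Mh) :
    |∫ U, f U * h U ∂μ| ≤ Mf * Real.sqrt (∫ U, (h U) ^ 2 ∂μ) := by
  have hMf0 : 0 ≤ Mf := (abs_nonneg _).trans (hMf 1)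
  have mf : MemLp f 2 μ := MemLp.of_bound hf.aestronglyMeasurable Mf
    (ae_of_all _ fun U => by rw [Real.norm_eq_abs]; exact hMf U)
  have mnf : MemLp (fun U => -f U) 2 μ := mf.neg
  have mh : MemLp h 2 μ := MemLp.of_bound hh.aestronglyMeasurable Mh
    (ae_of_all _ fun U => by rw [Real.norm_eq_abs]; exact hMh U)
  have hsq : Real.sqrt (∫ U, (f U) ^ 2 ∂μ) ≤ Mf := by
    have hle : ∫ U, (f U) ^ 2 ∂μ ≤ Mf ^ 2 := by
      have := integral_mono_of_nonneg (μ := μ) (ae_of_all _ fun U => sq_nonneg (f U))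
        (integrable_const (Mf ^ 2)) (ae_of_all _ fun U => show (f U) ^ 2 ≤ Mf ^ 2 from by
          calc (f U) ^ 2 = |f U| ^ 2 := (sq_abs _).symm
            _ ≤ Mf ^ 2 := pow_le_pow_left₀ (abs_nonneg _) (hMf U) 2)
      simpa only [integral_const, probReal_univ, one_smul] using this
    calc Real.sqrt (∫ U, (f U) ^ 2 ∂μ) ≤ Real.sqrt (Mf ^ 2) := Real.sqrt_le_sqrt hle
      _ = Mf := Real.sqrt_sq hMf0
  have hsq' : Real.sqrt (∫ U, (-f U) ^ 2 ∂μ) ≤ Mf := by simpa only [neg_sq] using hsq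
  have h1 := SusceptibilityToPoincare.TwoBlock.integral_mul_le_sqrt_mul_sqrt mf mh
  have h2 := SusceptibilityToPoincare.TwoBlock.integral_mul_le_sqrt_mul_sqrt mnf mh
  have hS0 : 0 ≤ Real.sqrt (∫ U, (h U) ^ 2 ∂μ) := Real.sqrt_nonneg _
  rw [abs_le]
  constructor
  · have : ∫ U, -f U * h U ∂μ = -∫ U, f U * h U ∂μ := by
      rw [← integral_neg]
      exact integral_congr_ae (ae_of_all _ fun U => by ring)
    rw [this] at h2
    nlinarith [mul_le_mul_of_nonneg_right hsq' hS0]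
  · nlinarith [mul_le_mul_of_nonneg_right hsq hS0]

variable [SecondCountableTopology G]

/-- One step of the telescoping sum: `∫ f h − ∫ f K h = |E|⁻¹ ∑_ℓ ∫ f (h − E_ℓ h)`. [folklore] -/
theorem integral_mul_sub_integral_mul_scanOp [NeZero d] (hρ : Continuous ρ) {f h : GaugeConfig d L G → ℝ}
    (hf : Measurable f) (hh : Measurable h) {Mf Mh : ℝ} (hMf : ∀ U, |f U| ≤ Mf)
    (hMh : ∀ U, |h U| ≤ Mh) :
    ∫ U, f U * h U ∂(wilsonMeasure (d := d) (L := L) ρ β) -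
        ∫ U, f U * scanOp ρ β h U ∂(wilsonMeasure (d := d) (L := L) ρ β) =
      (Fintype.card (Edge d L) : ℝ)⁻¹ * ∑ ℓ : Edge d L,
        ∫ U, f U * (h U - hbOp ρ β ℓ h U) ∂(wilsonMeasure (d := d) (L := L) ρ β) := by
  haveI := isProbabilityMeasure_wilsonMeasure (d := d) (L := L) ρ hρ β
  have hn0 : (Fintype.card (Edge d L) : ℝ) ≠ 0 := by exact_mod_cast Fintype.card_ne_zero
  have hpt : ∀ U, f U * h U - f U * scanOp ρ β h U =
      (Fintype.card (Edge d L) : ℝ)⁻¹ * ∑ ℓ : Edge d L, f U * (h U - hbOp ρ β ℓ h U) := by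
    intro U
    unfold scanOp
    rw [Finset.mul_sum, Finset.mul_sum, Finset.mul_sum]
    simp only [mul_sub, Finset.sum_sub_distrib, Finset.sum_const, Finset.card_univ, nsmul_eq_mul]
    field_simp
  have i1 : Integrable (fun U => f U * h U) (wilsonMeasure (d := d) (L := L) ρ β) :=
    integrable_of_measurable_of_abs_le (hf.mul hh) (fun U => abs_mul_le_mul (hMf U) (hMh U))
  have i2 : Integrable (fun U => f U * scanOp ρ β h U) (wilsonMeasure (d := d) (L := L) ρ β) :=
    integrable_of_measurable_of_abs_le (hf.mul (measurable_scanOp ρ β hρ hh))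
      (fun U => abs_mul_le_mul (hMf U) (abs_scanOp_le ρ β hρ hMh U))
  have i3 : ∀ ℓ, Integrable (fun U => f U * (h U - hbOp ρ β ℓ h U))
      (wilsonMeasure (d := d) (L := L) ρ β) := fun ℓ =>
    integrable_of_measurable_of_abs_le (hf.mul (hh.sub (measurable_hbOp ρ β hρ ℓ hh))) (C := Mf * (Mh + Mh))
      (fun U => abs_mul_le_mul (hMf U) ((abs_sub _ _).trans
        (add_le_add (hMh U) (abs_hbOp_le ρ β hρ ℓ hMh U))))
  rw [← integral_sub i1 i2]
  simp only [hpt]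
  rw [integral_const_mul, integral_finsetSum _ fun ℓ _ => i3 ℓ]

/-- Links not read by `f` do not contribute: `∫ f (h − E_ℓ h) dμ = 0` if `f` ignores `ℓ`
(pull-out and DLR). [folklore] -/
theorem integral_mul_sub_hbOp_eq_zero (hρ : Continuous ρ) {f h : GaugeConfig d L G → ℝ}
    (hf : Measurable f) (hh : Measurable h) {Mf Mh : ℝ} (hMf : ∀ U, |f U| ≤ Mf)
    (hMh : ∀ U, |h U| ≤ Mh) {ℓ : Edge d L} (hfl : ∀ U g', f (Function.update U ℓ g') = f U) :
    ∫ U, f U * (h U - hbOp ρ β ℓ h U) ∂(wilsonMeasure (d := d) (L := L) ρ β) = 0 := by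
  haveI := isProbabilityMeasure_wilsonMeasure (d := d) (L := L) ρ hρ β
  have i1 : Integrable (fun U => f U * h U) (wilsonMeasure (d := d) (L := L) ρ β) :=
    integrable_of_measurable_of_abs_le (hf.mul hh) (fun U => abs_mul_le_mul (hMf U) (hMh U))
  have i2 : Integrable (fun U => f U * hbOp ρ β ℓ h U) (wilsonMeasure (d := d) (L := L) ρ β) :=
    integrable_of_measurable_of_abs_le (hf.mul (measurable_hbOp ρ β hρ ℓ hh))
      (fun U => abs_mul_le_mul (hMf U) (abs_hbOp_le ρ β hρ ℓ hMh U))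
  have hpull : ∀ U, hbOp ρ β ℓ (fun V => f V * h V) U = f U * hbOp ρ β ℓ h U := fun U =>
    hbOp_mul_left ρ β ℓ hfl U
  simp only [mul_sub]
  rw [integral_sub i1 i2]
  simp only [← hpull]
  rw [integral_hbOp_wilsonMeasure ρ β hρ ℓ (h := fun V => f V * h V) (hf.mul hh)
    (fun U => abs_mul_le_mul (hMf U) (hMh U)), sub_self]

/-- **Covariance decay on one torus from the heat-bath Poincaré inequality** (gap + finite
speed of propagation of the discrete-time single-link heat bath; see the module docstring for
the statement and the proof) (Martinelli 1999 §3; Liggett 2005 Ch. I §4). [folklore] -/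
theorem abs_cov_le [NeZero d] (hρ : Continuous ρ) {C : ℝ} (hC : 1 ≤ C)
    (hP : ∀ F : GaugeConfig d L G → ℝ, Measurable F → (∃ M : ℝ, ∀ U, |F U| ≤ M) →
      variance F (wilsonMeasure (d := d) (L := L) ρ β) ≤
        C * ∑ ℓ : Edge d L, ∫ U, ∫ g, (F U - F (Function.update U ℓ g)) ^ 2 ∂(hbLaw ρ β ℓ U)
          ∂(wilsonMeasure (d := d) (L := L) ρ β))
    {f g : GaugeConfig d L G → ℝ} (hf : Measurable f) (hg : Measurable g) {Mf Mg : ℝ}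
    (hMf : ∀ U, |f U| ≤ Mf) (hMg : ∀ U, |g U| ≤ Mg)
    (Tf : Finset (Edge d L)) (hTf : ∀ ℓ, ℓ ∉ Tf → ∀ U g', f (Function.update U ℓ g') = f U)
    (c : ZMod L) (nR : ℕ) (hfar : ∀ ℓ ∈ Tf, nR ≤ tdist c ℓ)
    {a A₀ : ℝ} (ha0 : 0 < a) (ha1 : a ≤ 1) (hA₀ : 0 ≤ A₀)
    (hgo : ∀ ℓ, osc g ℓ ≤ A₀ * a ^ tdist c ℓ) (k : ℕ) :
    |(∫ U, f U * g U ∂(wilsonMeasure (d := d) (L := L) ρ β)) -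
        (∫ U, f U ∂(wilsonMeasure (d := d) (L := L) ρ β)) *
          ∫ U, g U ∂(wilsonMeasure (d := d) (L := L) ρ β)| ≤
      2 * Mf * Mg * Real.exp (-(k / (4 * C))) +
        k * Tf.card * Mf * (A₀ * Real.exp (2 * ((d + 1) * (d + d * d) : ℕ) / a * k)) * a ^ nR := by
  haveI := isProbabilityMeasure_wilsonMeasure (d := d) (L := L) ρ hρ β
  have hMf0 : 0 ≤ Mf := (abs_nonneg _).trans (hMf 1)
  have hMg0 : 0 ≤ Mg := (abs_nonneg _).trans (hMg 1)
  have hn0 : (0 : ℝ) < Fintype.card (Edge d L) := by exact_mod_cast Fintype.card_pos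
  have hC0 : 0 < C := by linarith
  have hCn : 1 ≤ 2 * C * Fintype.card (Edge d L) := by
    have : (1 : ℝ) ≤ Fintype.card (Edge d L) := by exact_mod_cast Fintype.card_pos
    nlinarith
  -- the centred observable `g₀ = g − ∫ g`
  have hgbar : |∫ U, g U ∂(wilsonMeasure (d := d) (L := L) ρ β)| ≤ Mg := by
    have := norm_integral_le_of_norm_le_const (μ := wilsonMeasure (d := d) (L := L) ρ β)
      (f := g) (C := Mg) (ae_of_all _ fun U => by rw [Real.norm_eq_abs]; exact hMg U)
    simpa only [Real.norm_eq_abs, probReal_univ, mul_one] using this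
  set g₀ : GaugeConfig d L G → ℝ := fun U => g U - ∫ V, g V ∂(wilsonMeasure (d := d) (L := L) ρ β)
    with hg₀
  have hg₀m : Measurable g₀ := hg.sub measurable_const
  have hg₀b : ∀ U, |g₀ U| ≤ 2 * Mg := fun U =>
    (abs_sub _ _).trans (by linarith [hMg U, hgbar])
  have hgi : Integrable g (wilsonMeasure (d := d) (L := L) ρ β) := integrable_of_measurable_of_abs_le hg hMg
  have hg₀i : ∫ U, g₀ U ∂(wilsonMeasure (d := d) (L := L) ρ β) = 0 := by
    simp only [hg₀]
    rw [integral_sub hgi (integrable_const _), integral_const, probReal_univ, one_smul, sub_self]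
  have hg₀o : ∀ ℓ, osc g₀ ℓ ≤ A₀ * a ^ tdist c ℓ := fun ℓ => by
    rw [hg₀, osc_sub_const]
    exact hgo ℓ
  -- iterates `h_j = K^j g₀`
  have hjm : ∀ j, Measurable (scanIter ρ β j g₀) := fun j => measurable_scanIter ρ β hρ hg₀m j
  have hjb : ∀ j U, |scanIter ρ β j g₀ U| ≤ 2 * Mg := fun j U => abs_scanIter_le ρ β hρ hg₀b j U
  -- covariance = `∫ f g₀`, and telescoping
  have hfi : Integrable f (wilsonMeasure (d := d) (L := L) ρ β) := integrable_of_measurable_of_abs_le hf hMf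
  have hfgi : Integrable (fun U => f U * g U) (wilsonMeasure (d := d) (L := L) ρ β) :=
    integrable_of_measurable_of_abs_le (hf.mul hg) (fun U => abs_mul_le_mul (hMf U) (hMg U))
  have hcov : (∫ U, f U * g U ∂(wilsonMeasure (d := d) (L := L) ρ β)) -
      (∫ U, f U ∂(wilsonMeasure (d := d) (L := L) ρ β)) *
        ∫ U, g U ∂(wilsonMeasure (d := d) (L := L) ρ β) =
      ∫ U, f U * g₀ U ∂(wilsonMeasure (d := d) (L := L) ρ β) := by
    simp only [hg₀, mul_sub]
    rw [integral_sub hfgi (hfi.mul_const _), integral_mul_const]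
  set J : ℕ := k * Fintype.card (Edge d L) with hJ
  set I : ℕ → ℝ := fun j => ∫ U, f U * scanIter ρ β j g₀ U ∂(wilsonMeasure (d := d) (L := L) ρ β)
    with hI
  have htel : ∫ U, f U * g₀ U ∂(wilsonMeasure (d := d) (L := L) ρ β) =
      I J + ∑ j ∈ Finset.range J, (I j - I (j + 1)) := by
    rw [Finset.sum_range_sub']
    simp only [hI, scanIter_zero]
    ring
  -- term 1: the gap
  have hT1 : |I J| ≤ 2 * Mf * Mg * Real.exp (-(k / (4 * C))) := by
    have h1 : |I J| ≤ Mf * Real.sqrt (∫ U, (scanIter ρ β J g₀ U) ^ 2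
        ∂(wilsonMeasure (d := d) (L := L) ρ β)) :=
      abs_integral_mul_le_mul_sqrt hf (hjm J) hMf (hjb J)
    have h2 := integral_sq_scanIter_le ρ β hρ hC0 hCn hP hg₀m hg₀b hg₀i J
    have h3 : ∫ U, (g₀ U) ^ 2 ∂(wilsonMeasure (d := d) (L := L) ρ β) ≤ (2 * Mg) ^ 2 := by
      have := integral_mono_of_nonneg (μ := wilsonMeasure (d := d) (L := L) ρ β)
        (ae_of_all _ fun U => sq_nonneg (g₀ U)) (integrable_const ((2 * Mg) ^ 2))
        (ae_of_all _ fun U => show (g₀ U) ^ 2 ≤ (2 * Mg) ^ 2 from by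
          calc (g₀ U) ^ 2 = |g₀ U| ^ 2 := (sq_abs _).symm
            _ ≤ (2 * Mg) ^ 2 := pow_le_pow_left₀ (abs_nonneg _) (hg₀b U) 2)
      simpa only [integral_const, probReal_univ, one_smul] using this
    have h4 : (1 - (2 * C * Fintype.card (Edge d L))⁻¹) ^ J ≤ Real.exp (-(k / (2 * C))) := by
      have hx : 1 - (2 * C * Fintype.card (Edge d L))⁻¹ ≤
          Real.exp (-(2 * C * Fintype.card (Edge d L))⁻¹) := by
        linarith [Real.add_one_le_exp (-(2 * C * Fintype.card (Edge d L))⁻¹)]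
      have h0 : 0 ≤ 1 - (2 * C * Fintype.card (Edge d L))⁻¹ :=
        sub_nonneg.2 (inv_le_one_of_one_le₀ hCn)
      calc (1 - (2 * C * Fintype.card (Edge d L))⁻¹) ^ J
          ≤ Real.exp (-(2 * C * Fintype.card (Edge d L))⁻¹) ^ J := pow_le_pow_left₀ h0 hx J
        _ = Real.exp (-(k / (2 * C))) := by
            rw [← Real.exp_nat_mul]
            congr 1
            rw [hJ]
            push_cast
            field_simp
    have h5 : Real.sqrt (∫ U, (scanIter ρ β J g₀ U) ^ 2 ∂(wilsonMeasure (d := d) (L := L) ρ β)) ≤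
        Real.exp (-(k / (4 * C))) * (2 * Mg) := by
      have hle : ∫ U, (scanIter ρ β J g₀ U) ^ 2 ∂(wilsonMeasure (d := d) (L := L) ρ β) ≤
          (Real.exp (-(k / (4 * C))) * (2 * Mg)) ^ 2 :=
        calc _ ≤ _ := h2
          _ ≤ Real.exp (-(k / (2 * C))) * (2 * Mg) ^ 2 :=
              mul_le_mul h4 h3 (integral_nonneg fun U => sq_nonneg _) (Real.exp_pos _).le
          _ = (Real.exp (-(k / (4 * C))) * (2 * Mg)) ^ 2 := by
              have hexp : Real.exp (-(k / (2 * C))) = Real.exp (-(k / (4 * C))) ^ 2 := by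
                rw [← Real.exp_nat_mul]
                congr 1
                push_cast
                ring
              rw [hexp]
              ring
      calc _ ≤ Real.sqrt ((Real.exp (-(k / (4 * C))) * (2 * Mg)) ^ 2) := Real.sqrt_le_sqrt hle
        _ = _ := Real.sqrt_sq (by positivity)
    calc |I J| ≤ _ := h1
      _ ≤ Mf * (Real.exp (-(k / (4 * C))) * (2 * Mg)) := mul_le_mul_of_nonneg_left h5 hMf0
      _ = 2 * Mf * Mg * Real.exp (-(k / (4 * C))) := by ring
  -- term 2: finite speed of propagation
  set q : ℝ := 1 + 2 * ((d + 1) * (d + d * d) : ℕ) / (a * Fintype.card (Edge d L)) with hq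
  have hq1 : 1 ≤ q := by rw [hq]; exact le_add_of_nonneg_right (by positivity)
  have hqJ : q ^ J ≤ Real.exp (2 * ((d + 1) * (d + d * d) : ℕ) / a * k) := by
    have := one_add_div_pow_mul_le_exp (x := 2 * ((d + 1) * (d + d * d) : ℕ) / a)
      (by positivity) (Fintype.card_pos (α := Edge d L)) k
    convert this using 2
    rw [hq, div_div]
  have hB0 : 0 ≤ Mf * (A₀ * q ^ J * a ^ nR) := by positivity
  have hterm : ∀ j, j < J → |I j - I (j + 1)| ≤
      (Fintype.card (Edge d L) : ℝ)⁻¹ * (Tf.card * (Mf * (A₀ * q ^ J * a ^ nR))) := by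
    intro j hjJ
    have hdiff : I j - I (j + 1) = (Fintype.card (Edge d L) : ℝ)⁻¹ * ∑ ℓ : Edge d L,
        ∫ U, f U * (scanIter ρ β j g₀ U - hbOp ρ β ℓ (scanIter ρ β j g₀) U)
          ∂(wilsonMeasure (d := d) (L := L) ρ β) := by
      simp only [hI, scanIter_succ]
      exact integral_mul_sub_integral_mul_scanOp ρ β hρ hf (hjm j) hMf (hjb j)
    -- each link of `Tf` contributes at most `Mf A₀ q^J a^{nR}`, the others `0`
    have hℓ : ∀ ℓ, |∫ U, f U * (scanIter ρ β j g₀ U - hbOp ρ β ℓ (scanIter ρ β j g₀) U)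
        ∂(wilsonMeasure (d := d) (L := L) ρ β)| ≤
        if ℓ ∈ Tf then Mf * (A₀ * q ^ J * a ^ nR) else 0 := by
      intro ℓ
      split_ifs with hmem
      · have hoscj : ∀ V g', |scanIter ρ β j g₀ (Function.update V ℓ g') - scanIter ρ β j g₀ V| ≤
            A₀ * q ^ j * a ^ tdist c ℓ := fun V g' =>
          (abs_sub_le_osc (hjb j) ℓ V g').trans
            (osc_scanIter_le_geom ρ β hρ hg₀m hg₀b c ha0 ha1 hA₀ hg₀o j ℓ)
        have hpt : ∀ U, |f U * (scanIter ρ β j g₀ U - hbOp ρ β ℓ (scanIter ρ β j g₀) U)| ≤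
            Mf * (A₀ * q ^ J * a ^ nR) := fun U => by
          rw [abs_mul]
          refine mul_le_mul (hMf U) ?_ (abs_nonneg _) hMf0
          refine (abs_sub_hbOp_le ρ β hρ ℓ (hjm j) (hjb j) hoscj U).trans ?_
          refine mul_le_mul (mul_le_mul_of_nonneg_left (pow_le_pow_right₀ hq1 hjJ.le) hA₀)
            (pow_le_pow_of_le_one ha0.le ha1 (hfar ℓ hmem)) (by positivity) (by positivity)
        have := norm_integral_le_of_norm_le_const (μ := wilsonMeasure (d := d) (L := L) ρ β)
          (f := fun U => f U * (scanIter ρ β j g₀ U - hbOp ρ β ℓ (scanIter ρ β j g₀) U))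
          (C := Mf * (A₀ * q ^ J * a ^ nR))
          (ae_of_all _ fun U => by rw [Real.norm_eq_abs]; exact hpt U)
        simpa only [Real.norm_eq_abs, probReal_univ, mul_one] using this
      · rw [integral_mul_sub_hbOp_eq_zero ρ β hρ hf (hjm j) hMf (hjb j) (hTf ℓ hmem), abs_zero]
    rw [hdiff, abs_mul, abs_inv, Nat.abs_cast]
    refine mul_le_mul_of_nonneg_left ?_ (by positivity)
    calc |∑ ℓ : Edge d L, ∫ U, f U * (scanIter ρ β j g₀ U - hbOp ρ β ℓ (scanIter ρ β j g₀) U)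
          ∂(wilsonMeasure (d := d) (L := L) ρ β)|
        ≤ ∑ ℓ : Edge d L, |∫ U, f U * (scanIter ρ β j g₀ U - hbOp ρ β ℓ (scanIter ρ β j g₀) U)
          ∂(wilsonMeasure (d := d) (L := L) ρ β)| := Finset.abs_sum_le_sum_abs _ _
      _ ≤ ∑ ℓ : Edge d L, (if ℓ ∈ Tf then Mf * (A₀ * q ^ J * a ^ nR) else 0) :=
          Finset.sum_le_sum fun ℓ _ => hℓ ℓ
      _ = Tf.card * (Mf * (A₀ * q ^ J * a ^ nR)) := by
          rw [Finset.sum_ite_mem, Finset.univ_inter, Finset.sum_const, nsmul_eq_mul]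
  have hT2 : |∑ j ∈ Finset.range J, (I j - I (j + 1))| ≤
      k * Tf.card * Mf * (A₀ * Real.exp (2 * ((d + 1) * (d + d * d) : ℕ) / a * k)) * a ^ nR := by
    calc |∑ j ∈ Finset.range J, (I j - I (j + 1))|
        ≤ ∑ j ∈ Finset.range J, |I j - I (j + 1)| := Finset.abs_sum_le_sum_abs _ _
      _ ≤ ∑ _j ∈ Finset.range J,
            (Fintype.card (Edge d L) : ℝ)⁻¹ * (Tf.card * (Mf * (A₀ * q ^ J * a ^ nR))) :=
          Finset.sum_le_sum fun j hj => hterm j (Finset.mem_range.1 hj)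
      _ = k * Tf.card * Mf * (A₀ * q ^ J) * a ^ nR := by
          rw [Finset.sum_const, Finset.card_range, nsmul_eq_mul, hJ]
          push_cast
          field_simp
      _ ≤ _ := by
          have hk : (0 : ℝ) ≤ k * Tf.card * Mf := by positivity
          have := mul_le_mul_of_nonneg_left hqJ hA₀
          nlinarith [pow_nonneg ha0.le nR, mul_nonneg hk (pow_nonneg ha0.le nR)]
  -- conclusion
  rw [hcov, htel]
  exact (abs_add_le _ _).trans (add_le_add hT1 hT2)

end Covariance

end Summit.QuantumFields.YangMills.Theorems.PoincareClustering

end
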